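import Literature.NumberTheory.Transcendental.KZMellinFibres
import HarnessLib

/-!
# Beta chains in the Kontsevich–Zagier calculus, II: the two Dirichlet charts

Dirichlet's re-association `B(a,b)·B(a+b,c) = B(b,c)·B(a,b+c)` (both sides equal
`Γ(a)Γ(b)Γ(c)/Γ(a+b+c)`, Andrews–Askey–Roy 1999, Thm 1.8.1) realised INSIDE the rules of
Kontsevich–Zagier (2001, §1.2) as two single change-of-variables moves through the open simplex
`Δ = {x > 0, y > 0, x + y < 1}` with the Dirichlet integrand `x^{a-1} y^{b-1} (1-x-y)^{c-1}`:

* `KZ.exists_dirichletPolarChart` — the polar chart `Φ(u,v) = (uv, u(1-v))` of `Δ` by the box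
  `(0,1)²` (`|det DΦ| = u`, polynomial, injective, onto) and
  `KZ.dirichletPolar_equivalent`: `[(0,1)², u^{a+b-1}(1-u)^{c-1} · v^{a-1}(1-v)^{b-1}] ∼ [Δ, …]`
  (the simplex representation EXISTS: Euler–Mellin semialgebraic, integrable by the chart and
  Mathlib's Jacobian criterion from the given box representation);
* `KZ.exists_dirichletLinearChart` — the linear chart `Ψ(t,u) = (u, (1-u)t)` (`|det DΨ| = 1-u`) and
  `KZ.dirichletLinear_equivalent`: `[Δ, …] ∼ [(0,1)², t^{b-1}(1-t)^{c-1} · u^{a-1}(1-u)^{b+c-1}]`.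

All statements are for representations PINNED by domain and integrand; everything is proved, no
`def`, no named fact. (Adapted from the BetaCancellation disprover's charts, gen 2 §15.)
-/

noncomputable section

open MeasureTheory Set
open Literature.ModelTheory.ExponentialFields (IsSemialgebraic isSemialgebraic_setOf_eval_pos)
open MvPolynomial (aeval X C)

namespace Literature.NumberTheory.Transcendental

namespace KZ

/-! ## The box and the simplex -/

/-- The open box `(0,1)²` (coordinate spelling) is `ℚ`-semialgebraic. [folklore] -/
theorem isSemialgebraic_box2 :
    IsSemialgebraic ℚ {z : Fin 2 → ℝ | z 0 ∈ Set.Ioo (0:ℝ) 1 ∧ z 1 ∈ Set.Ioo (0:ℝ) 1} := by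
  convert KZ.isSemialgebraic_box 2 using 1
  ext x
  simp only [mem_setOf_eq, Fin.forall_fin_two]

/-- The open box `(0,1)²` is measurable. [folklore] -/
theorem measurableSet_box2 :
    MeasurableSet {z : Fin 2 → ℝ | z 0 ∈ Set.Ioo (0:ℝ) 1 ∧ z 1 ∈ Set.Ioo (0:ℝ) 1} :=
  isSemialgebraic_box2.measurableSet_holds

/-- The open simplex `{x > 0, y > 0, x + y < 1}` is `ℚ`-semialgebraic. [folklore] -/
theorem isSemialgebraic_simplex2 :
    IsSemialgebraic ℚ {z : Fin 2 → ℝ | 0 < z 0 ∧ 0 < z 1 ∧ z 0 + z 1 < 1} := by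
  have h := isSemialgebraic_setOf_forall_aeval_pos
    ![MvPolynomial.X 0, MvPolynomial.X 1, (1 - MvPolynomial.X 0 - MvPolynomial.X 1 : MvPolynomial (Fin 2) ℚ)]
  convert h using 1
  ext x
  simp only [mem_setOf_eq, Fin.forall_fin_succ, Matrix.cons_val_zero, Matrix.cons_val_succ, map_sub,
    map_one, MvPolynomial.aeval_X]
  constructor
  · rintro ⟨h0, h1, h2⟩; exact ⟨h0, h1, by linarith, fun i => Fin.elim0 i⟩
  · rintro ⟨h0, h1, h2, -⟩; exact ⟨h0, h1, by linarith⟩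

/-- The Dirichlet integrand `x^{a-1} y^{b-1} (1-x-y)^{c-1}` is `ℚ`-semialgebraic on the open simplex
(Euler–Mellin, three factors). [folklore] -/
theorem isSemialgebraicFunOn_dirichletKernel (a b c : ℚ) :
    IsSemialgebraicFunOn ℚ {z : Fin 2 → ℝ | 0 < z 0 ∧ 0 < z 1 ∧ z 0 + z 1 < 1}
      (fun z => (z 0) ^ ((a:ℝ) - 1) * (z 1) ^ ((b:ℝ) - 1) * (1 - z 0 - z 1) ^ ((c:ℝ) - 1)) := by
  refine (isSemialgebraicFunOn_mellinIntegrand isSemialgebraic_simplex2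
    ![MvPolynomial.X 0, MvPolynomial.X 1, 1 - MvPolynomial.X 0 - MvPolynomial.X 1]
    ![a - 1, b - 1, c - 1] 1 (fun x hx k => ?_)).congr fun x _ => ?_
  · obtain ⟨h0, h1, h2⟩ := hx
    fin_cases k
    · simpa using h0
    · simpa using h1
    · simp only [Fin.reduceFinMk, Matrix.cons_val, map_sub, map_one, MvPolynomial.aeval_X]
      linarith
  · simp [mellinIntegrand_apply, Fin.prod_univ_three]

/-! ## The pull-back identities -/

/-- POLAR chart `Φ(u,v) = (uv, u(1-v))`, `|det Φ'| = u`: the Dirichlet integrand pulled back along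
`Φ` and multiplied by the Jacobian is `u^{a+b-1}(1-u)^{c-1} · v^{a-1}(1-v)^{b-1}`. [folklore] -/
theorem dirichlet_pullback_polar (a b c : ℝ) {u v : ℝ} (hu : 0 < u) (hv : 0 < v) (hv1 : v < 1) :
    (u * v) ^ (a - 1) * (u * (1 - v)) ^ (b - 1) * (1 - u * v - u * (1 - v)) ^ (c - 1) * u =
      u ^ (a + b - 1) * (1 - u) ^ (c - 1) * (v ^ (a - 1) * (1 - v) ^ (b - 1)) := by
  have h1v : 0 < 1 - v := by linarith
  have e : 1 - u * v - u * (1 - v) = 1 - u := by ring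
  rw [e, Real.mul_rpow hu.le hv.le, Real.mul_rpow hu.le h1v.le]
  have hu' : u ^ (a + b - 1) = u ^ (a - 1) * u ^ (b - 1) * u := by
    rw [← Real.rpow_add hu, ← Real.rpow_add_one hu.ne']
    congr 1
    ring
  rw [hu']
  ring

/-- LINEAR chart `Ψ(t,u) = (u, (1-u)t)`, `|det Ψ'| = 1 - u`: the Dirichlet integrand pulled back
along `Ψ` and multiplied by the Jacobian is `t^{b-1}(1-t)^{c-1} · u^{a-1}(1-u)^{b+c-1}`. [folklore] -/
theorem dirichlet_pullback_linear (a b c : ℝ) {t u : ℝ} (ht : 0 < t) (ht1 : t < 1) (hu1 : u < 1) :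
    u ^ (a - 1) * ((1 - u) * t) ^ (b - 1) * (1 - u - (1 - u) * t) ^ (c - 1) * (1 - u) =
      t ^ (b - 1) * (1 - t) ^ (c - 1) * (u ^ (a - 1) * (1 - u) ^ (b + c - 1)) := by
  have h1u : 0 < 1 - u := by linarith
  have h1t : 0 < 1 - t := by linarith
  have e : 1 - u - (1 - u) * t = (1 - u) * (1 - t) := by ring
  rw [e, Real.mul_rpow h1u.le ht.le, Real.mul_rpow h1u.le h1t.le]
  have hu' : (1 - u) ^ (b + c - 1) = (1 - u) ^ (b - 1) * (1 - u) ^ (c - 1) * (1 - u) := by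
    rw [← Real.rpow_add h1u, ← Real.rpow_add_one h1u.ne']
    congr 1
    ring
  rw [hu']
  ring

/-! ## The two charts of the simplex by the box -/

/-- **The polar chart `Φ(u,v) = (uv, u(1-v))`** of the open simplex by the open box: a
`ℚ`-polynomial map, differentiable with `|det DΦ| = u`, injective on the box and ONTO the simplex
(inverse `u = x + y`, `v = x/(x+y)`). [folklore] -/
theorem exists_dirichletPolarChart :
    ∃ (Φ : (Fin 2 → ℝ) → (Fin 2 → ℝ)) (Φ' : (Fin 2 → ℝ) → (Fin 2 → ℝ) →L[ℝ] (Fin 2 → ℝ)),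
      (∀ z, Φ z 0 = z 0 * z 1) ∧ (∀ z, Φ z 1 = z 0 * (1 - z 1)) ∧
      IsSemialgebraicMapOn ℚ {z : Fin 2 → ℝ | z 0 ∈ Set.Ioo (0:ℝ) 1 ∧ z 1 ∈ Set.Ioo (0:ℝ) 1} Φ ∧
      (∀ z, HasFDerivAt Φ (Φ' z) z) ∧
      Set.InjOn Φ {z : Fin 2 → ℝ | z 0 ∈ Set.Ioo (0:ℝ) 1 ∧ z 1 ∈ Set.Ioo (0:ℝ) 1} ∧
      Φ '' {z : Fin 2 → ℝ | z 0 ∈ Set.Ioo (0:ℝ) 1 ∧ z 1 ∈ Set.Ioo (0:ℝ) 1} =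
        {z : Fin 2 → ℝ | 0 < z 0 ∧ 0 < z 1 ∧ z 0 + z 1 < 1} ∧
      (∀ z ∈ {z : Fin 2 → ℝ | z 0 ∈ Set.Ioo (0:ℝ) 1 ∧ z 1 ∈ Set.Ioo (0:ℝ) 1}, |(Φ' z).det| = z 0) := by
  set Φ : (Fin 2 → ℝ) → (Fin 2 → ℝ) := fun z => ![z 0 * z 1, z 0 * (1 - z 1)] with hΦ
  set Φ' : (Fin 2 → ℝ) → (Fin 2 → ℝ) →L[ℝ] (Fin 2 → ℝ) :=
    fun z => LinearMap.toContinuousLinearMap (Matrix.toLin' !![z 1, z 0; 1 - z 1, -(z 0)]) with hΦ'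
  have hΦ0 : ∀ z, Φ z 0 = z 0 * z 1 := fun z => rfl
  have hΦ1 : ∀ z, Φ z 1 = z 0 * (1 - z 1) := fun z => rfl
  have hΦ'0 : ∀ z v : Fin 2 → ℝ, Φ' z v 0 = z 1 * v 0 + z 0 * v 1 := by
    intro z v
    change Matrix.toLin' !![z 1, z 0; 1 - z 1, -(z 0)] v 0 = _
    rw [Matrix.toLin'_apply]
    simp [Matrix.mulVec, dotProduct, Fin.sum_univ_two]
  have hΦ'1 : ∀ z v : Fin 2 → ℝ, Φ' z v 1 = (1 - z 1) * v 0 + -(z 0) * v 1 := by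
    intro z v
    change Matrix.toLin' !![z 1, z 0; 1 - z 1, -(z 0)] v 1 = _
    rw [Matrix.toLin'_apply]
    simp [Matrix.mulVec, dotProduct, Fin.sum_univ_two]
  have hdet : ∀ z, (Φ' z).det = -(z 0) := by
    intro z
    change LinearMap.det (Matrix.toLin' !![z 1, z 0; 1 - z 1, -(z 0)]) = _
    rw [LinearMap.det_toLin', Matrix.det_fin_two]
    simp
    ring
  have hderiv : ∀ z, HasFDerivAt Φ (Φ' z) z := by
    intro z
    have h0 : HasFDerivAt (fun y : Fin 2 → ℝ => y 0)
        (ContinuousLinearMap.proj (R := ℝ) (φ := fun _ : Fin 2 => ℝ) 0) z := hasFDerivAt_apply 0 z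
    have h1 : HasFDerivAt (fun y : Fin 2 → ℝ => y 1)
        (ContinuousLinearMap.proj (R := ℝ) (φ := fun _ : Fin 2 => ℝ) 1) z := hasFDerivAt_apply 1 z
    rw [hasFDerivAt_pi']
    refine Fin.forall_fin_two.mpr ⟨?_, ?_⟩
    · have hf : (fun y : Fin 2 → ℝ => Φ y 0) = fun y => y 0 * y 1 := funext fun y => rfl
      rw [hf]
      refine (h0.mul h1).congr_fderiv (ContinuousLinearMap.ext fun v => ?_)
      simp [hΦ'0]
      ring
    · have hf : (fun y : Fin 2 → ℝ => Φ y 1) = fun y => y 0 * (1 - y 1) := funext fun y => rfl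
      rw [hf]
      refine (h0.mul (h1.const_sub 1)).congr_fderiv (ContinuousLinearMap.ext fun v => ?_)
      simp [hΦ'1]
      ring
  refine ⟨Φ, Φ', hΦ0, hΦ1, ?_, hderiv, ?_, ?_, fun z hz => ?_⟩
  · convert isSemialgebraicMapOn_aeval isSemialgebraic_box2
      ![MvPolynomial.X 0 * MvPolynomial.X 1, MvPolynomial.X 0 * (1 - MvPolynomial.X 1)] using 2 with z
    funext i
    fin_cases i
    · simp [hΦ0]
    · simp [hΦ1]
  · intro x hx y hy hxy
    have e0 := congrFun hxy 0
    have e1 := congrFun hxy 1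
    simp only [hΦ0, hΦ1] at e0 e1
    have h0 : x 0 = y 0 := by linarith
    have h1 : x 1 = y 1 := by
      rw [h0] at e0
      exact mul_left_cancel₀ hy.1.1.ne' e0
    funext i
    fin_cases i
    · exact h0
    · exact h1
  · ext y
    constructor
    · rintro ⟨z, ⟨h0, h1⟩, rfl⟩
      simp only [mem_setOf_eq, hΦ0, hΦ1]
      refine ⟨mul_pos h0.1 h1.1, mul_pos h0.1 (sub_pos.2 h1.2), ?_⟩
      nlinarith [h0.2]
    · rintro ⟨hy0, hy1, hy2⟩
      have hs : 0 < y 0 + y 1 := by linarith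
      refine ⟨![y 0 + y 1, y 0 / (y 0 + y 1)], ⟨?_, ?_⟩, ?_⟩
      · change y 0 + y 1 ∈ Set.Ioo (0:ℝ) 1
        exact ⟨hs, hy2⟩
      · change y 0 / (y 0 + y 1) ∈ Set.Ioo (0:ℝ) 1
        exact ⟨div_pos hy0 hs, by rw [div_lt_one hs]; linarith⟩
      · funext i
        fin_cases i
        · change (y 0 + y 1) * (y 0 / (y 0 + y 1)) = y 0
          field_simp
        · change (y 0 + y 1) * (1 - y 0 / (y 0 + y 1)) = y 1
          field_simp
          ring
  · rw [hdet, abs_neg, abs_of_pos hz.1.1]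

/-- **The linear chart `Ψ(t,u) = (u, (1-u)t)`** of the open simplex by the open box (affine in each
fibre): a `ℚ`-polynomial map, differentiable with `|det DΨ| = 1 - u`, injective on the box and ONTO
the simplex (inverse `u = x`, `t = y/(1-x)`). [folklore] -/
theorem exists_dirichletLinearChart :
    ∃ (Ψ : (Fin 2 → ℝ) → (Fin 2 → ℝ)) (Ψ' : (Fin 2 → ℝ) → (Fin 2 → ℝ) →L[ℝ] (Fin 2 → ℝ)),
      (∀ z, Ψ z 0 = z 1) ∧ (∀ z, Ψ z 1 = (1 - z 1) * z 0) ∧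
      IsSemialgebraicMapOn ℚ {z : Fin 2 → ℝ | z 0 ∈ Set.Ioo (0:ℝ) 1 ∧ z 1 ∈ Set.Ioo (0:ℝ) 1} Ψ ∧
      (∀ z, HasFDerivAt Ψ (Ψ' z) z) ∧
      Set.InjOn Ψ {z : Fin 2 → ℝ | z 0 ∈ Set.Ioo (0:ℝ) 1 ∧ z 1 ∈ Set.Ioo (0:ℝ) 1} ∧
      Ψ '' {z : Fin 2 → ℝ | z 0 ∈ Set.Ioo (0:ℝ) 1 ∧ z 1 ∈ Set.Ioo (0:ℝ) 1} =
        {z : Fin 2 → ℝ | 0 < z 0 ∧ 0 < z 1 ∧ z 0 + z 1 < 1} ∧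
      (∀ z ∈ {z : Fin 2 → ℝ | z 0 ∈ Set.Ioo (0:ℝ) 1 ∧ z 1 ∈ Set.Ioo (0:ℝ) 1},
        |(Ψ' z).det| = 1 - z 1) := by
  set Ψ : (Fin 2 → ℝ) → (Fin 2 → ℝ) := fun z => ![z 1, (1 - z 1) * z 0] with hΨ
  set Ψ' : (Fin 2 → ℝ) → (Fin 2 → ℝ) →L[ℝ] (Fin 2 → ℝ) :=
    fun z => LinearMap.toContinuousLinearMap (Matrix.toLin' !![0, 1; 1 - z 1, -(z 0)]) with hΨ'
  have hΨ0 : ∀ z, Ψ z 0 = z 1 := fun z => rfl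
  have hΨ1 : ∀ z, Ψ z 1 = (1 - z 1) * z 0 := fun z => rfl
  have hΨ'0 : ∀ z v : Fin 2 → ℝ, Ψ' z v 0 = v 1 := by
    intro z v
    change Matrix.toLin' !![0, 1; 1 - z 1, -(z 0)] v 0 = _
    rw [Matrix.toLin'_apply]
    simp [Matrix.mulVec, dotProduct, Fin.sum_univ_two]
  have hΨ'1 : ∀ z v : Fin 2 → ℝ, Ψ' z v 1 = (1 - z 1) * v 0 + -(z 0) * v 1 := by
    intro z v
    change Matrix.toLin' !![0, 1; 1 - z 1, -(z 0)] v 1 = _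
    rw [Matrix.toLin'_apply]
    simp [Matrix.mulVec, dotProduct, Fin.sum_univ_two]
  have hdet : ∀ z, (Ψ' z).det = -(1 - z 1) := by
    intro z
    change LinearMap.det (Matrix.toLin' !![0, 1; 1 - z 1, -(z 0)]) = _
    rw [LinearMap.det_toLin', Matrix.det_fin_two]
    simp
  have hderiv : ∀ z, HasFDerivAt Ψ (Ψ' z) z := by
    intro z
    have h0 : HasFDerivAt (fun y : Fin 2 → ℝ => y 0)
        (ContinuousLinearMap.proj (R := ℝ) (φ := fun _ : Fin 2 => ℝ) 0) z := hasFDerivAt_apply 0 z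
    have h1 : HasFDerivAt (fun y : Fin 2 → ℝ => y 1)
        (ContinuousLinearMap.proj (R := ℝ) (φ := fun _ : Fin 2 => ℝ) 1) z := hasFDerivAt_apply 1 z
    rw [hasFDerivAt_pi']
    refine Fin.forall_fin_two.mpr ⟨?_, ?_⟩
    · have hf : (fun y : Fin 2 → ℝ => Ψ y 0) = fun y => y 1 := funext fun y => rfl
      rw [hf]
      refine h1.congr_fderiv (ContinuousLinearMap.ext fun v => ?_)
      simp [hΨ'0]
    · have hf : (fun y : Fin 2 → ℝ => Ψ y 1) = fun y => (1 - y 1) * y 0 := funext fun y => rfl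
      rw [hf]
      refine ((h1.const_sub 1).mul h0).congr_fderiv (ContinuousLinearMap.ext fun v => ?_)
      simp [hΨ'1]
  refine ⟨Ψ, Ψ', hΨ0, hΨ1, ?_, hderiv, ?_, ?_, fun z hz => ?_⟩
  · convert isSemialgebraicMapOn_aeval isSemialgebraic_box2
      ![MvPolynomial.X 1, (1 - MvPolynomial.X 1) * MvPolynomial.X 0] using 2 with z
    funext i
    fin_cases i
    · simp [hΨ0]
    · simp [hΨ1]
  · intro x hx y hy hxy
    have e0 := congrFun hxy 0
    have e1 := congrFun hxy 1
    simp only [hΨ0, hΨ1] at e0 e1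
    have h0 : x 0 = y 0 := by
      rw [e0] at e1
      exact mul_left_cancel₀ (sub_pos.2 hy.2.2).ne' e1
    funext i
    fin_cases i
    · exact h0
    · exact e0
  · ext y
    constructor
    · rintro ⟨z, ⟨h0, h1⟩, rfl⟩
      simp only [mem_setOf_eq, hΨ0, hΨ1]
      refine ⟨h1.1, mul_pos (sub_pos.2 h1.2) h0.1, ?_⟩
      nlinarith [h0.2, sub_pos.2 h1.2]
    · rintro ⟨hy0, hy1, hy2⟩
      have h3 : 0 < 1 - y 0 := by linarith
      refine ⟨![y 1 / (1 - y 0), y 0], ⟨?_, ?_⟩, ?_⟩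
      · change y 1 / (1 - y 0) ∈ Set.Ioo (0:ℝ) 1
        exact ⟨div_pos hy1 h3, by rw [div_lt_one h3]; linarith⟩
      · change y 0 ∈ Set.Ioo (0:ℝ) 1
        exact ⟨hy0, by linarith⟩
      · funext i
        fin_cases i
        · rfl
        · change (1 - y 0) * (y 1 / (1 - y 0)) = y 1
          field_simp
  · rw [hdet, abs_neg, abs_of_pos (sub_pos.2 hz.2.2)]

/-! ## The two moves -/

/-- **Dirichlet re-association, polar half** (`stub_dirichletPolar` of the BetaCancellation line,
generalised to an arbitrary third exponent): a representation pinned as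
`[(0,1)², u^{a+b-1}(1-u)^{c-1} · v^{a-1}(1-v)^{b-1}]` is equivalent, by ONE change of variables
along the polar chart, to a representation pinned as the Dirichlet simplex integral
`[Δ, x^{a-1} y^{b-1} (1-x-y)^{c-1}]`, WHICH EXISTS (its integrability is transported from the given
box representation by the Jacobian criterion). Value identity:
`B(a+b,c)·B(a,b) = Γ(a)Γ(b)Γ(c)/Γ(a+b+c)`. [cite: AndrewsAskeyRoy1999, Thm 1.8.1] -/
theorem dirichletPolar_equivalent (a b c : ℚ) (P : IntegralRep 2)
    (hPd : P.domain = {z | z 0 ∈ Set.Ioo (0:ℝ) 1 ∧ z 1 ∈ Set.Ioo (0:ℝ) 1})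
    (hPi : Set.EqOn P.integrand (fun z => (z 0) ^ ((a:ℝ) + b - 1) * (1 - z 0) ^ ((c:ℝ) - 1) *
      ((z 1) ^ ((a:ℝ) - 1) * (1 - z 1) ^ ((b:ℝ) - 1))) P.domain) :
    ∃ S : IntegralRep 2,
      S.domain = {z | 0 < z 0 ∧ 0 < z 1 ∧ z 0 + z 1 < 1} ∧
      Set.EqOn S.integrand (fun z => (z 0) ^ ((a:ℝ) - 1) * (z 1) ^ ((b:ℝ) - 1) *
        (1 - z 0 - z 1) ^ ((c:ℝ) - 1)) S.domain ∧
      Equivalent P S := by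
  obtain ⟨Φ, Φ', hΦ0, hΦ1, hsa, hderiv, hinj, himage, hdet⟩ := exists_dirichletPolarChart
  set K : (Fin 2 → ℝ) → ℝ := fun z => (z 0) ^ ((a:ℝ) - 1) * (z 1) ^ ((b:ℝ) - 1) *
    (1 - z 0 - z 1) ^ ((c:ℝ) - 1) with hK
  -- integrability of the Dirichlet kernel, pulled back through Φ to the given P
  have hbox : IntegrableOn (fun z => |(Φ' z).det| • K (Φ z))
      {z : Fin 2 → ℝ | z 0 ∈ Set.Ioo (0:ℝ) 1 ∧ z 1 ∈ Set.Ioo (0:ℝ) 1} := by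
    have h1 : IntegrableOn P.integrand {z : Fin 2 → ℝ | z 0 ∈ Set.Ioo (0:ℝ) 1 ∧ z 1 ∈ Set.Ioo (0:ℝ) 1} :=
      hPd ▸ P.integrableOn
    refine h1.congr_fun (fun z hz => ?_) measurableSet_box2
    rw [hPi (by rw [hPd]; exact hz), smul_eq_mul, mul_comm, hdet z hz]
    simp only [hK, hΦ0, hΦ1]
    exact (dirichlet_pullback_polar _ _ _ hz.1.1 hz.2.1 hz.2.2).symm
  have hint : IntegrableOn K {z : Fin 2 → ℝ | 0 < z 0 ∧ 0 < z 1 ∧ z 0 + z 1 < 1} := by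
    rw [← himage, integrableOn_image_iff_integrableOn_abs_det_fderiv_smul volume
      measurableSet_box2 (fun x _ => (hderiv x).hasFDerivWithinAt) hinj]
    exact hbox
  obtain ⟨S, hSd, hSi⟩ : ∃ S : IntegralRep 2,
      S.domain = {z | 0 < z 0 ∧ 0 < z 1 ∧ z 0 + z 1 < 1} ∧ S.integrand = K :=
    ⟨⟨_, _, isSemialgebraic_simplex2, isSemialgebraicFunOn_dirichletKernel a b c, hint⟩, rfl, rfl⟩
  refine ⟨S, hSd, fun z _ => by rw [hSi], ?_⟩
  refine changeOfVariablesRel_subset_relations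
    ⟨2, P, S, Φ, Φ', by rw [hPd]; exact hsa, fun x _ => (hderiv x).hasFDerivWithinAt,
      by rw [hPd]; exact hinj, by rw [hPd, hSd, himage], fun z hz => ?_, rfl⟩
  have hz' : z 0 ∈ Set.Ioo (0:ℝ) 1 ∧ z 1 ∈ Set.Ioo (0:ℝ) 1 := by rw [hPd] at hz; exact hz
  rw [hPi hz, hSi, hdet z hz']
  simp only [hK, hΦ0, hΦ1]
  exact (dirichlet_pullback_polar _ _ _ hz'.1.1 hz'.2.1 hz'.2.2).symm

/-- **Dirichlet re-association, linear half** (`stub_dirichletLinear` of the BetaCancellation line,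
generalised to an arbitrary third exponent): a representation pinned as the Dirichlet simplex
integral `[Δ, x^{a-1} y^{b-1} (1-x-y)^{c-1}]` is equivalent, by ONE change of variables along the
linear chart, to a representation pinned as `[(0,1)², t^{b-1}(1-t)^{c-1} · u^{a-1}(1-u)^{b+c-1}]`.
Value identity: `Γ(a)Γ(b)Γ(c)/Γ(a+b+c) = B(b,c)·B(a,b+c)`. [cite: AndrewsAskeyRoy1999, Thm 1.8.1] -/
theorem dirichletLinear_equivalent (a b c : ℚ) (S B : IntegralRep 2)
    (hSd : S.domain = {z | 0 < z 0 ∧ 0 < z 1 ∧ z 0 + z 1 < 1})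
    (hSi : Set.EqOn S.integrand (fun z => (z 0) ^ ((a:ℝ) - 1) * (z 1) ^ ((b:ℝ) - 1) *
      (1 - z 0 - z 1) ^ ((c:ℝ) - 1)) S.domain)
    (hBd : B.domain = {z | z 0 ∈ Set.Ioo (0:ℝ) 1 ∧ z 1 ∈ Set.Ioo (0:ℝ) 1})
    (hBi : Set.EqOn B.integrand (fun z => (z 0) ^ ((b:ℝ) - 1) * (1 - z 0) ^ ((c:ℝ) - 1) *
      ((z 1) ^ ((a:ℝ) - 1) * (1 - z 1) ^ ((b:ℝ) + c - 1))) B.domain) :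
    Equivalent S B := by
  obtain ⟨Ψ, Ψ', hΨ0, hΨ1, hsa, hderiv, hinj, himage, hdet⟩ := exists_dirichletLinearChart
  have hmem : of B - of S ∈ changeOfVariablesRel := by
    refine ⟨2, B, S, Ψ, Ψ', by rw [hBd]; exact hsa, fun x _ => (hderiv x).hasFDerivWithinAt,
      by rw [hBd]; exact hinj, by rw [hBd, hSd, himage], fun z hz => ?_, rfl⟩
    have hz' : z 0 ∈ Set.Ioo (0:ℝ) 1 ∧ z 1 ∈ Set.Ioo (0:ℝ) 1 := by rw [hBd] at hz; exact hz
    have hΨz : Ψ z ∈ S.domain := by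
      rw [hSd, ← himage]
      exact mem_image_of_mem Ψ hz'
    rw [hBi hz, hSi hΨz, hdet z hz']
    simp only [hΨ0, hΨ1]
    exact (dirichlet_pullback_linear _ _ _ hz'.1.1 hz'.1.2 hz'.2.2).symm
  exact Equivalent.symm (changeOfVariablesRel_subset_relations hmem)

end KZ

end Literature.NumberTheory.Transcendental
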